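import Summits.Schanuel.Schanuel.Theorems.ZilberEacComplexMovingPolydiscLocal
import Mathlib.Analysis.SpecialFunctions.Complex.LogBounds
import HarnessLib

/-!
# Moving polydiscs around GENERAL centres: arbitrary logarithm branches, ε-closeness, sequences

Zilber's Exponential-Algebraic Closedness, case ladder (host summit Schanuel, cell `pub-schanuel`,
seat 2, gen 11).  `ZilberEacComplexMovingPolydiscLocal.exists_exp_eq_poly_add_near_latticeCentre_local`
solves `exp xⱼ = Aⱼ(x) + P_{m,j}(x)` near the lattice centres `m v + log Aⱼ(m v)` (PRINCIPAL
logarithm) under relative smallness `‖P_{m,j}‖ ≤ θ m^{dⱼ}`.  The invariant-direction regime of this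
generation (`ZilberEacInvariantDirectionExistence`) needs three small upgrades, supplied here:

* `exists_exp_eq_poly_add_near_centre` — the SAME contraction around ANY centres `c(m)` with
  `exp c(m)ⱼ = Aⱼ(m v)` and `‖c(m) - m v‖ = o(m)` (so any branch of the logarithm, and any bounded
  shift `2πi p`, are allowed), with the conclusion `‖x - c(m)‖ ≤ ε` for every prescribed `ε > 0`
  (a posteriori: `ξⱼ = log(1 + z)` with `‖z‖ ≤ 2κ`);
* `exists_seq_of_forall_eventually_exists_near` — from "for every `ε`, eventually a solution within
  `ε`" to ONE sequence of solutions `x(m)` with `x(m) - c(m) → 0` (diagonal extraction);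
* `exists_norm_polynomial_eval_le_pow` — `‖f(z)‖ ≤ C (1 + ‖z‖)^N` for `f ∈ ℂ[z]`.

HONEST FRAMING: infrastructure (D'Aquino–Fornasiero–Terzo-type contraction); `EC(3,2)` OPEN;
nothing here bears on Schanuel's conjecture (EAC ⇏ SC).
-/

noncomputable section

open Complex MvPolynomial Metric Set Filter Topology

set_option linter.dupNamespace false

namespace Summit.Schanuel.Schanuel.Theorems

/-! ### Diagonal extraction -/

/-- **Diagonal extraction.**  If for every `ε > 0`, for all large `m` some `x ∈ S m` has
`‖x - c m‖ ≤ ε`, then there is ONE sequence `x(m)` with `x(m) ∈ S m` for all large `m` and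
`x(m) - c(m) → 0`. [folklore] -/
theorem exists_seq_of_forall_eventually_exists_near {E : Type*} [NormedAddCommGroup E]
    (S : ℕ → Set E) (c : ℕ → E)
    (h : ∀ ε : ℝ, 0 < ε → ∀ᶠ m : ℕ in atTop, ∃ x ∈ S m, ‖x - c m‖ ≤ ε) :
    ∃ x : ℕ → E, (∀ᶠ m : ℕ in atTop, x m ∈ S m) ∧ Tendsto (fun m => x m - c m) atTop (𝓝 0) := by
  classical
  have hk : ∀ k : ℕ, ∃ M : ℕ, ∀ m ≥ M, ∃ x ∈ S m, ‖x - c m‖ ≤ 1 / ((k : ℝ) + 1) := fun k =>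
    eventually_atTop.1 (h _ (by positivity))
  choose M hM using hk
  -- the level reached at time `m`
  set lev : ℕ → ℕ := fun m => Nat.findGreatest (fun k => M k ≤ m) m with hlev
  have hlev_spec : ∀ m, M 0 ≤ m → M (lev m) ≤ m := by
    intro m hm
    have : ∃ k, k ≤ m ∧ M k ≤ m := ⟨0, Nat.zero_le _, hm⟩
    exact Nat.findGreatest_spec (P := fun k => M k ≤ m) (Nat.zero_le m) hm
  have hlev_ge : ∀ K m, M K ≤ m → K ≤ m → K ≤ lev m := fun K m hKM hKm =>
    Nat.le_findGreatest hKm hKM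
  have hlev_top : Tendsto lev atTop atTop := by
    refine tendsto_atTop_atTop.2 fun K => ⟨max (M K) K, fun m hm => ?_⟩
    exact hlev_ge K m ((le_max_left _ _).trans hm) ((le_max_right _ _).trans hm)
  -- the sequence
  have hchoice : ∀ m, ∃ x : E, M 0 ≤ m → x ∈ S m ∧ ‖x - c m‖ ≤ 1 / ((lev m : ℝ) + 1) := by
    intro m
    by_cases hm : M 0 ≤ m
    · obtain ⟨x, hxS, hx⟩ := hM (lev m) m (hlev_spec m hm)
      exact ⟨x, fun _ => ⟨hxS, hx⟩⟩
    · exact ⟨c m, fun h' => absurd h' hm⟩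
  choose x hx using hchoice
  refine ⟨x, ?_, ?_⟩
  · filter_upwards [eventually_ge_atTop (M 0)] with m hm
    exact (hx m hm).1
  · rw [tendsto_zero_iff_norm_tendsto_zero]
    have hlim : Tendsto (fun m => 1 / ((lev m : ℝ) + 1)) atTop (𝓝 0) := by
      have h1 : Tendsto (fun m => (lev m : ℝ) + 1) atTop atTop :=
        tendsto_atTop_add_const_right _ _ (tendsto_natCast_atTop_atTop.comp hlev_top)
      exact tendsto_const_nhds.div_atTop h1
    refine squeeze_zero_norm' ?_ hlim
    filter_upwards [eventually_ge_atTop (M 0)] with m hm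
    rw [norm_norm]
    exact (hx m hm).2

/-! ### A polynomial bound -/

/-- `‖f(z)‖ ≤ C (1 + ‖z‖)^N` for a univariate polynomial. [folklore] -/
theorem exists_norm_polynomial_eval_le_pow (f : Polynomial ℂ) :
    ∃ C : ℝ, 0 ≤ C ∧ ∃ N : ℕ, ∀ z : ℂ, ‖f.eval z‖ ≤ C * (1 + ‖z‖) ^ N := by
  obtain ⟨C, hC, N, hCN⟩ :=
    Literature.NumberTheory.Transcendental.HypersurfaceCover.exists_norm_eval_le_pow
      (f.toMvPolynomial (0 : Fin 1))
  refine ⟨C, hC, N, fun z => ?_⟩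
  have h := hCN (fun _ => z)
  rw [MvPolynomial.eval_toMvPolynomial] at h
  have hnorm : ‖(fun _ : Fin 1 => z)‖ = ‖z‖ := by
    simp [pi_norm_const]
  rwa [hnorm] at h

/-! ### The contraction around general centres -/

/-- `‖ξ‖ ≤ 1/2` and `exp ξ = 1 + z` with `‖z‖ ≤ 1/2` force `‖ξ‖ ≤ (3/2) ‖z‖`. [folklore] -/
theorem norm_le_of_exp_eq_one_add {ξ z : ℂ} (hξ : ‖ξ‖ ≤ 1 / 2) (hz : ‖z‖ ≤ 1 / 2)
    (h : exp ξ = 1 + z) : ‖ξ‖ ≤ 3 / 2 * ‖z‖ := by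
  have him : |ξ.im| ≤ 1 / 2 := (Complex.abs_im_le_norm ξ).trans hξ
  have hlog : log (exp ξ) = ξ := Complex.log_exp
    (by linarith [neg_abs_le ξ.im, Real.two_le_pi])
    (by linarith [le_abs_self ξ.im, Real.two_le_pi])
  rw [← hlog, h]
  exact Complex.norm_log_one_add_half_le_self hz

/-- **Moving-polydisc perturbation theorem around general centres.**  `q ∈ ℤˢ`, `v = 2πi q`,
`Aⱼ ∈ ℂ[x₁..xₛ]` with `(Aⱼ)_{dⱼ}(v) ≠ 0`; centres `c(m)` with `exp c(m)ⱼ = Aⱼ(m v)` (any branch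
of the logarithm, any shift by `2πi ℤˢ`) and `‖c(m) - m v‖ + 1 ≤ δ m` for every `δ > 0` eventually;
perturbations `P_{m,j}` holomorphic on the unit polydisc around `c(m)` with `‖P_{m,j}‖ ≤ θ m^{dⱼ}`
there for every `θ > 0` eventually.  Then for every `ε > 0`, for all large `m` the system
`exp xⱼ = Aⱼ(x) + P_{m,j}(x)` has a solution with `‖x - c(m)‖ ≤ ε`.  (Same contraction as
`exists_exp_eq_poly_add_near_latticeCentre_local`; the `ε` comes from `ξⱼ = log(1 + zⱼ)`,
`‖zⱼ‖ ≤ 2κ`.) [cite: DaquinoFornasieroTerzo2017, Lemma 2.2 (contraction step)] -/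
theorem exists_exp_eq_poly_add_near_centre {s : ℕ} (q : Fin s → ℤ)
    (A : Fin s → MvPolynomial (Fin s) ℂ)
    (hA : ∀ j, eval (fun i => 2 * Real.pi * I * (q i : ℂ))
      (homogeneousComponent (A j).totalDegree (A j)) ≠ 0)
    (c : ℕ → Fin s → ℂ)
    (hcexp : ∀ᶠ m : ℕ in atTop, ∀ j,
      exp (c m j) = eval (fun k => (m : ℂ) * (2 * Real.pi * I * (q k : ℂ))) (A j))
    (hcsmall : ∀ δ : ℝ, 0 < δ → ∀ᶠ m : ℕ in atTop,
      ‖c m - fun i => (m : ℂ) * (2 * Real.pi * I * (q i : ℂ))‖ + 1 ≤ δ * m)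
    (P : ℕ → Fin s → (Fin s → ℂ) → ℂ)
    (hP : ∀ᶠ m : ℕ in atTop, ∀ j, DifferentiableOn ℂ (P m j) (ball (c m) 1))
    (hPsmall : ∀ j, ∀ θ : ℝ, 0 < θ → ∀ᶠ m : ℕ in atTop, ∀ ξ : Fin s → ℂ, ‖ξ‖ < 1 →
      ‖P m j (c m + ξ)‖ ≤ θ * (m : ℝ) ^ (A j).totalDegree)
    {ε : ℝ} (hε : 0 < ε) :
    ∀ᶠ m : ℕ in atTop, ∃ x : Fin s → ℂ,
      ‖x - c m‖ ≤ ε ∧ ∀ j, exp (x j) = eval x (A j) + P m j x := by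
  classical
  set v : Fin s → ℂ := fun j => 2 * Real.pi * I * (q j : ℂ) with hv
  set w : ℕ → Fin s → ℂ := fun m j => (m : ℂ) * v j with hw
  set α : ℕ → Fin s → ℂ := fun m j => eval (w m) (A j) with hαdef
  -- the contraction constant
  set κ : ℝ := min (1 / (64 * (s + 1))) (ε / 8) with hκdef
  have hκ : 0 < κ := lt_min (by positivity) (by positivity)
  have hκ1 : κ ≤ 1 / (64 * (s + 1)) := min_le_left _ _
  have hκ2 : κ ≤ ε / 8 := min_le_right _ _
  have hκ64 : κ ≤ 1 / 64 := hκ1.trans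
    (one_div_le_one_div_of_le (by norm_num) (by nlinarith [(Nat.cast_nonneg s : (0 : ℝ) ≤ s)]))
  have hctrl := fun j => latticeValue_control (A j) v (hA j) hκ
  choose ρ hρ t₀ ht₀ hc using hctrl
  set a : Fin s → ℝ := fun j => ‖eval v (homogeneousComponent (A j).totalDegree (A j))‖ with ha
  have ha0 : ∀ j, 0 < a j := fun j => norm_pos_iff.mpr (hA j)
  -- ### eventual facts
  have hev1 : ∀ᶠ m : ℕ in atTop, ∀ j, t₀ j ≤ (m : ℝ) :=
    eventually_all.2 fun j => tendsto_natCast_atTop_atTop.eventually_ge_atTop (t₀ j)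
  have hev3 : ∀ᶠ m : ℕ in atTop, ∀ j, ‖c m - w m‖ + 1 ≤ ρ j * m :=
    eventually_all.2 fun j => hcsmall (ρ j) (hρ j)
  have hev4 : ∀ᶠ m : ℕ in atTop, ∀ j, ∀ ξ : Fin s → ℂ, ‖ξ‖ < 1 →
      ‖P m j (c m + ξ)‖ ≤ a j / 2 * κ * (m : ℝ) ^ (A j).totalDegree :=
    eventually_all.2 fun j => hPsmall j _ (by have := ha0 j; positivity)
  -- ### fix `m`
  filter_upwards [hev1, hev3, hev4, hP, hcexp] with m hm1 hm3 hm4 hmP hmc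
  have hfacts := fun j => hc j m (hm1 j)
  have hα0 : ∀ j, α m j ≠ 0 := fun j => (hfacts j).1
  have hexpc : ∀ j, exp (c m j) = α m j := hmc
  -- the total perturbation and its RELATIVE bound `2κ`
  set Pt : Fin s → (Fin s → ℂ) → ℂ := fun j x => (eval x (A j) - α m j) + P m j x with hPt
  have hPtdiff : ∀ j, DifferentiableOn ℂ (Pt j) (ball (c m) 1) := fun j =>
    ((differentiable_mvPolynomial_eval (A j)).differentiableOn.sub_const _).add (hmP j)
  have hPtb2 : ∀ j, ∀ ξ : Fin s → ℂ, ‖ξ‖ < 1 → ‖Pt j (c m + ξ)‖ ≤ 2 * κ * ‖α m j‖ := by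
    intro j ξ hξ
    have hη : ‖(c m - w m) + ξ‖ ≤ ρ j * m := by
      refine (norm_add_le _ _).trans ?_
      have := hm3 j
      linarith [hξ.le]
    have hsplit : c m + ξ = w m + ((c m - w m) + ξ) := by abel
    have h1 : ‖eval (c m + ξ) (A j) - α m j‖ ≤ κ * ‖α m j‖ := by
      rw [hsplit]
      exact (hfacts j).2.2.2 _ hη
    have h2 : ‖P m j (c m + ξ)‖ ≤ κ * ‖α m j‖ := by
      refine (hm4 j ξ hξ).trans ?_
      have h3 : a j / 2 * (m : ℝ) ^ (A j).totalDegree ≤ ‖α m j‖ := (hfacts j).2.1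
      have h4 : a j / 2 * κ * (m : ℝ) ^ (A j).totalDegree =
          κ * (a j / 2 * (m : ℝ) ^ (A j).totalDegree) := by ring
      rw [h4]
      exact mul_le_mul_of_nonneg_left h3 hκ.le
    calc ‖Pt j (c m + ξ)‖ ≤ ‖eval (c m + ξ) (A j) - α m j‖ + ‖P m j (c m + ξ)‖ := norm_add_le _ _
      _ ≤ κ * ‖α m j‖ + κ * ‖α m j‖ := add_le_add h1 h2
      _ = 2 * κ * ‖α m j‖ := by ring
  have hPtb : ∀ j, ∀ ξ : Fin s → ℂ, ‖ξ‖ < 1 → ‖Pt j (c m + ξ)‖ ≤ ‖α m j‖ / (16 * (s + 1)) := by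
    intro j ξ hξ
    refine (hPtb2 j ξ hξ).trans ?_
    rw [le_div_iff₀ (by positivity)]
    have hs : (0 : ℝ) ≤ s := Nat.cast_nonneg s
    have h1 : κ * (64 * ((s : ℝ) + 1)) ≤ 1 := by
      have := hκ1
      rwa [le_div_iff₀ (by positivity)] at this
    nlinarith [norm_nonneg (α m j)]
  obtain ⟨ξ, hξ, hsol⟩ := exists_exp_eq_add_local (c m) (α m) Pt hexpc hα0 hPtdiff hPtb
  refine ⟨c m + ξ, ?_, fun j => ?_⟩
  · -- a posteriori: `exp ξⱼ = 1 + Ptⱼ/αⱼ`, `‖Ptⱼ/αⱼ‖ ≤ 2κ ≤ 1/32`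
    rw [add_sub_cancel_left]
    refine (pi_norm_le_iff_of_nonneg hε.le).2 fun j => ?_
    have hξj : ‖ξ j‖ ≤ 1 / 2 := (norm_le_pi_norm ξ j).trans hξ
    have hξlt : ‖ξ‖ < 1 := lt_of_le_of_lt hξ (by norm_num)
    set z : ℂ := Pt j (c m + ξ) / α m j with hz
    have hzb : ‖z‖ ≤ 2 * κ := by
      rw [hz, norm_div, div_le_iff₀ (norm_pos_iff.2 (hα0 j))]
      exact hPtb2 j ξ hξlt
    have hz2 : ‖z‖ ≤ 1 / 2 := hzb.trans (by linarith)
    have hexpξ : exp (ξ j) = 1 + z := by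
      have h := hsol j
      rw [Complex.exp_add, hexpc j] at h
      have hα := hα0 j
      rw [hz]
      field_simp
      linear_combination h
    have := norm_le_of_exp_eq_one_add hξj hz2 hexpξ
    linarith
  · have h := hsol j
    simp only [Pi.add_apply] at h ⊢
    rw [h, hPt]
    ring

end Summit.Schanuel.Schanuel.Theorems
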